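import Summits.CriticalPhenomena.PercolationContinuityZ3.Theorems.Transplant.KNCellsBoxProdZ2ConcG
import Summits.CriticalPhenomena.PercolationContinuityZ3.Theorems.Transplant.PlanarCellsFaces
import HarnessLib

/-!
# The planar region of the FACE STEP `cond_j` of design (D) (§11 v2; residue (F)): above the stub `Stub_j` of `x` in direction `du` the far
# box is fresh; the tube step runs in `B_X(w₀, R) × farA` with `farA = cen x + {5r + 10 s j + 1 ≤ σ(t - cen x)_a ≤ 25 r} × [-5r, 5r]`, its
# levels are the enlargements of the face row `F^{j+1}` (`5r + 10 s (j+1)`, half-width `2r`), its true target is `B(w₀, Rt) × M(x + du)`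

builds on p205010 (kernel theorem, internal audit signed; external expert review pending) — nothing in this file uses p205010.
Lane `prim-bschramm`, seat `prim-bschramm-p3` (residue (F) of V56); helper file (`--supports stmt-CriticalPhenomena-4575 --as helper`).

Planar facts (`PCells`, unit `r = K s`): `farA ⊆ Efar`, `farA ∩ Stub_j = ∅`, `farA ∩ Q x = ∅`, `M(x+du) ⊆ farA` (`j ≤ K`), the
`k`-enlargement of the face row lies in `farA` for `k + 2 ≤ 10 s`, `k ≤ 3 r`, `j + 1 ≤ K`; `Efar ⊆ cen x + Λ_{25 r}`; `Efar ∩ Q x = ∅`.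
[cite: KozmaNitzan2024, §4 p. 26 (E^far, H^j), p. 30 (Step III: F^{j+1})]
-/

noncomputable section

namespace Summit.CriticalPhenomena.PercolationContinuityZ3.Theorems

namespace Transplant

open Literature.Probability.Percolation Literature.Probability.LatticeModels SimpleGraph GadgetSystem Contour
open Literature.Probability.Percolation.KozmaNitzan
open Literature.Probability.Percolation.KozmaNitzan.Cells (oth oth_ne sgOf sgOf_sign stepVec_apply_fst stepVec_apply_oth eq_oth_of_ne oth_oth)

namespace PCells

variable (C : PCells)

/-- **The fresh rows above the stub of level `j`**: `{5r + 10 s j + 1 ≤ level ≤ 25 r} × [-5r, 5r]`. [cite: KozmaNitzan2024, §4 p. 30] -/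
def farA (x : Site 2) (du : MDir) (j : ℕ) : Finset (Site 2) :=
  sBox du.1 (sgOf du) (C.cen x) (5 * C.r + 10 * C.s * j + 1) (25 * C.r) (5 * C.r)

/-- The face row of level `j` as a signed box (= `C.Face`). [folklore] -/
theorem Face_eq (x : Site 2) (du : MDir) (j : ℕ) :
    C.Face x du j = sBox du.1 (sgOf du) (C.cen x) (5 * C.r + 10 * C.s * j) (5 * C.r + 10 * C.s * j) (2 * C.r) := rfl

/-- `farA ⊆ E^far`. [folklore] -/
theorem farA_subset_Efar (x : Site 2) (du : MDir) (j : ℕ) : C.farA x du j ⊆ C.Efar x du := by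
  refine sBox_mono (sgOf_sign du) _ ?_ le_rfl le_rfl
  nlinarith [C.hs, Nat.zero_le j]

/-- `farA` misses the stub of level `j`. [folklore] -/
theorem farA_disjoint_Stub (x : Site 2) (du : MDir) (j : ℕ) : Disjoint (C.farA x du j) (C.Stub x du j) := by
  rw [Finset.disjoint_left]
  intro t ht ht'
  rw [farA, mem_psBox_iff] at ht
  rw [Stub, mem_psBox_iff] at ht'
  omega

/-- `farA` misses the cube `Q x`. [folklore] -/
theorem farA_disjoint_Q (x : Site 2) (du : MDir) (j : ℕ) : Disjoint (C.farA x du j) (C.Q x) := by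
  rw [Finset.disjoint_left]
  intro t ht ht'
  rw [farA, mem_psBox_iff] at ht
  rw [Q, C.mem_sq_iff] at ht'
  have h1 := ht' du.1
  push_cast at ht h1
  rcases sgOf_sign du with hs | hs <;> rw [hs] at ht <;> nlinarith [ht.1.1, h1.1, h1.2, C.one_le_r]

/-- `E^far` misses the cube `Q x`. [folklore] -/
theorem Efar_disjoint_Q (x : Site 2) (du : MDir) : Disjoint (C.Efar x du) (C.Q x) := by
  rw [Finset.disjoint_left]
  intro t ht ht'
  rw [Efar, mem_psBox_iff] at ht
  rw [Q, C.mem_sq_iff] at ht'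
  have h1 := ht' du.1
  push_cast at ht h1
  rcases sgOf_sign du with hs | hs <;> rw [hs] at ht <;> nlinarith [ht.1.1, h1.1, h1.2, C.one_le_r]

/-- **`M(x + du) ⊆ farA`** for `j ≤ K` (the middle box of the neighbour lies at levels `17r … 23r`). [cite: KozmaNitzan2024, §4 p. 26] -/
theorem M_add_stepVec_subset_farA (x : Site 2) (du : MDir) {j : ℕ} (hj : j ≤ C.K) : C.M (x + stepVec du) ⊆ C.farA x du j := by
  intro t ht
  rw [M, C.mem_sq_iff] at ht
  rw [farA, mem_psBox_iff]
  have h1 := ht du.1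
  have h2 := ht (oth du.1)
  rw [C.cen_add_stepVec_fst] at h1
  rw [C.cen_add_stepVec_oth] at h2
  have hsj : 10 * (C.s : ℤ) * j ≤ 10 * C.r := by
    have : (C.s : ℤ) * j ≤ C.r := by
      have h := Nat.mul_le_mul_left C.s hj
      rw [Nat.mul_comm C.s C.K] at h
      exact_mod_cast (show C.s * j ≤ C.r from h)
    linarith
  push_cast at h1 h2 ⊢
  refine ⟨?_, by constructor <;> linarith [h2.1, h2.2, C.one_le_r]⟩
  rcases sgOf_sign du with hs | hs <;> rw [hs] at h1 ⊢ <;> constructor <;> nlinarith [h1.1, h1.2, C.one_le_r]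

/-- **The `k`-enlargement of the face row `F^{j+1}` lies in `farA`** when `k + 2 ≤ 10 s`, `k ≤ 3 r`, `j + 1 ≤ K`.
[cite: KozmaNitzan2024, §4 p. 30 (the levels above F^{j+1})] -/
theorem Face_enlarge_subset_farA (x : Site 2) (du : MDir) {j k : ℕ} (hj : j + 1 ≤ C.K) (hk : k + 2 ≤ 10 * C.s) (hk' : k ≤ 3 * C.r) :
    Finset.Icc (sLo du.1 (sgOf du) (C.cen x) (5 * C.r + 10 * C.s * (j + 1 : ℕ)) (5 * C.r + 10 * C.s * (j + 1 : ℕ)) (2 * C.r) - (k : Site 2))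
      (sHi du.1 (sgOf du) (C.cen x) (5 * C.r + 10 * C.s * (j + 1 : ℕ)) (5 * C.r + 10 * C.s * (j + 1 : ℕ)) (2 * C.r) + (k : Site 2)) ⊆
      C.farA x du j := by
  rw [sBox_enlarge _ _ (sgOf_sign du), farA]
  have hsj : (C.s : ℤ) * (j + 1) ≤ C.r := by
    have h := Nat.mul_le_mul_left C.s hj
    rw [Nat.mul_comm C.s C.K] at h
    exact_mod_cast (show C.s * (j + 1) ≤ C.r from h)
  refine sBox_mono (sgOf_sign du) _ ?_ ?_ ?_ <;> push_cast <;> nlinarith [C.one_le_r, C.hs]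

/-- `E^far(x, du) ⊆ cen x + Λ_{25 r}`. [folklore] -/
theorem Efar_subset_box_image (x : Site 2) (du : MDir) : C.Efar x du ⊆ (box 2 (25 * C.r)).image (fun s => s + C.cen x) := by
  intro t ht
  rw [Efar, mem_psBox_iff] at ht
  refine Finset.mem_image.2 ⟨t - C.cen x, ?_, by abel⟩
  rw [mem_box]
  intro i
  simp only [Pi.sub_apply]
  push_cast
  by_cases hi : i = du.1
  · subst hi
    rcases sgOf_sign du with hs | hs <;> rw [hs] at ht <;> constructor <;> nlinarith [ht.1.1, ht.1.2, C.one_le_r]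
  · rw [eq_oth_of_ne hi]; constructor <;> linarith [ht.2.1, ht.2.2, C.one_le_r]

end PCells

end Transplant

end Summit.CriticalPhenomena.PercolationContinuityZ3.Theorems

end
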